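import Summits.QuantumFields.YangMills.Theorems.MirrorModularBoostsCurvatureBoostCovarianceGramVecOnStrip
import HarnessLib

/-!
# Holomorphic vectors on a strip from a sesqui-holomorphic Gram kernel, with exponential type —
stub `stub_stripGramVectors`

Line `boosts-inherit-mirrors` of crux `MirrorModularBoosts.CurvatureBoostCovariance`
(stmt-QuantumFields-9663), reshape 6 of the skeleton
`Cruxes/CurvatureBoostCovariance/Lines/boosts_inherit_mirrors.lean`: the abstract half of Stub 4a
(uniform planar boost vectors) in the form consumed by the lead's composition
(seat prover-line-stmt-QuantumFields-9663-1): from a kernel of exponential type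
`C e^{N(|Im θ'| + |Im θ|)}` on the bi-strip one gets vectors of exponential type `C' e^{N|Im θ|}`
on the strip.

Statement (`stub_stripGramVectors`; pure Hilbert-space complex analysis, model-blind).  Let `H` be
a complex Hilbert space, `ε > 0`, `Φ : ℝ → H`, and let `k : ℂ → ℂ → ℂ` be jointly holomorphic on the
bi-strip `{|Re θ'| < ε} × {|Re θ| < ε}`, of exponential type `‖k θ' θ‖ ≤ C e^{N(|Im θ'| + |Im θ|)}`,
and equal to the Gram kernel `⟪Φ θ', Φ θ⟫` at real points.  Then there is `V : ℂ → H`, holomorphic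
on the strip `{|Re θ| < ε}`, with `‖V θ‖ ≤ C' e^{N|Im θ|}` and `V θ = Φ θ` for real `|θ| < ε`.

Proof.  The landed `stub_gramVecOnStrip` (this directory, `…GramVecOnStrip.lean`: transport of the
tree's `exists_holomorphic_gramVec_polydisc`, Osterwalder–Schrader II Ch. V.2 (5.16)–(5.21), along
the chart `tan(π · /(4ε))` of the strip onto the unit disc) gives `V` holomorphic on the strip with
`V = Φ` on the real segment and the continued Gram identity `⟪V w, V z⟫ = k(w̄, z)` on the bi-strip.
At `w = z = θ`: `‖V θ‖² = Re k(θ̄, θ) ≤ ‖k(θ̄, θ)‖ ≤ C e^{N(|Im θ̄| + |Im θ|)} = C e^{2N|Im θ|}`,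
hence `‖V θ‖ ≤ √(max C 0) · e^{N|Im θ|}`.

References: K. Osterwalder, R. Schrader, *Axioms for Euclidean Green's functions II*, Comm. Math.
Phys. 42 (1975) 281–305, Ch. V.2, (5.16)–(5.21) (the norm identity is (5.21)).
-/

noncomputable section

namespace Summit.QuantumFields.YangMills.Theorems.CurvatureBoostCovariance.BoostsInheritMirrors

open scoped InnerProductSpace ComplexConjugate
open Literature.MathematicalPhysics.QuantumFieldTheory

/-- **Stub 4a-ii — holomorphic vectors on a strip from a sesqui-holomorphic Gram kernel, with
exponential type.**  If `k` is jointly holomorphic on the bi-strip `{|Re θ'| < ε} × {|Re θ| < ε}`,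
of exponential type `C e^{N(|Im θ'| + |Im θ|)}`, and restricts to the Gram kernel `⟪Φ θ', Φ θ⟫` on
the real square, then `Φ` continues from the real segment to a vector-valued map `V` holomorphic on
the strip with `‖V θ‖ ≤ C' e^{N|Im θ|}` (`‖V θ‖² = Re k(θ̄, θ) ≤ C e^{2N|Im θ|}`, `C' = √(max C 0)`).
Signature of the stub `stub_stripGramVectors` of the lead's reshape-6 skeleton for
`Cruxes/CurvatureBoostCovariance/Lines/boosts_inherit_mirrors.lean` (seat
prover-line-stmt-QuantumFields-9663-1), verbatim. -/
theorem stub_stripGramVectors :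
    ∀ (H : Type) [NormedAddCommGroup H] [InnerProductSpace ℂ H] [CompleteSpace H] (ε N C : ℝ), 0 < ε →
      ∀ (Φ : ℝ → H) (k : ℂ → ℂ → ℂ),
        DifferentiableOn ℂ (Function.uncurry k) ({θ : ℂ | |θ.re| < ε} ×ˢ {θ : ℂ | |θ.re| < ε}) →
        (∀ θ' θ : ℂ, |θ'.re| < ε → |θ.re| < ε → ‖k θ' θ‖ ≤ C * Real.exp (N * (|θ'.im| + |θ.im|))) →
        (∀ θ' θ : ℝ, |θ'| < ε → |θ| < ε → k θ' θ = inner ℂ (Φ θ') (Φ θ)) →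
        ∃ (V : ℂ → H) (C' : ℝ), DifferentiableOn ℂ V {θ : ℂ | |θ.re| < ε} ∧
          (∀ θ : ℂ, |θ.re| < ε → ‖V θ‖ ≤ C' * Real.exp (N * |θ.im|)) ∧
          ∀ θ : ℝ, |θ| < ε → V θ = Φ θ := by
  intro H _ _ _ ε N C hε Φ k hkd hkg hkr
  obtain ⟨V, hVd, hVr, hVg⟩ :=
    stub_gramVecOnStrip H ε hε Φ k hkd fun η η' hη hη' => (hkr η' η hη' hη).symm
  refine ⟨V, Real.sqrt (max C 0), hVd, fun θ hθ => ?_, hVr⟩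
  have hθ' : |(conj θ).re| < ε := by simpa using hθ
  have h1 : ‖V θ‖ ^ 2 = (k (conj θ) θ).re := by
    rw [← hVg θ θ hθ hθ, inner_self_re_eq_norm_sq]
  refine le_of_pow_le_pow_left₀ two_ne_zero (by positivity) ?_
  calc ‖V θ‖ ^ 2 = (k (conj θ) θ).re := h1
    _ ≤ ‖k (conj θ) θ‖ := Complex.re_le_norm _
    _ ≤ C * Real.exp (N * (|(conj θ).im| + |θ.im|)) := hkg _ _ hθ' hθ
    _ = C * (Real.exp (N * |θ.im|) * Real.exp (N * |θ.im|)) := by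
        rw [Complex.conj_im, abs_neg, mul_add, Real.exp_add]
    _ ≤ max C 0 * (Real.exp (N * |θ.im|) * Real.exp (N * |θ.im|)) := by
        gcongr; exact le_max_left _ _
    _ = (Real.sqrt (max C 0) * Real.exp (N * |θ.im|)) ^ 2 := by
        rw [mul_pow, Real.sq_sqrt (le_max_right _ _), pow_two]

end Summit.QuantumFields.YangMills.Theorems.CurvatureBoostCovariance.BoostsInheritMirrors

end
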